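import Literature.Probability.Percolation.IsoradialUniverseTransfer
import Summits.CriticalPhenomena.PercolationContinuityZ3.Theorems.AdditiveGluing.Negative.CertIsoSix

/-!
# Crux `NoHeavyLowerTail` (stmt-CriticalPhenomena-4575), certificate programme for the `|A| = 5` one-cut rung:
# relabelling invariance of the one-cut statement

The one-cut inequality for a weighted graph on `Fin n` — "if all pairwise relay cuts have probability `≤ t`
then `P(1 ≤ N < E N/2) ≤ t`" — is transported along any vertex permutation `σ`: it holds for
`(w, A, o)` as soon as it holds for `(w ∘ σ̂⁻¹, σ A, σ o)` (`oneCut_of_relabel`), by the relabelling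
invariance of `prodBernoulli` (`prodBernoulli_real_preimage_relabel`) and of connection events
(`AdditiveGluing.Negative.Cert.preimage_relabel_openConn`).  This lets a certificate checked for ONE position
of the observer / relay set serve all positions.  Bookkeeping only; nothing about the crux.
-/

namespace Summit.CriticalPhenomena.PercolationContinuityZ3.Theorems.TwoCopy

open Finset MeasureTheory
open Literature.Probability.Percolation Literature.Probability.LatticeModels
open Summit.CriticalPhenomena.PercolationContinuityZ3.Theorems.AdditiveGluing.Negative.Cert
open scoped Classical

/-- The weights transported along `σ`: `w^σ (σ̂ e) = w e`. [this work] -/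
noncomputable def relabelW {n : ℕ} (σ : Equiv.Perm (Fin n)) (w : Sym2 (Fin n) → unitInterval) :
    Sym2 (Fin n) → unitInterval :=
  fun z => w ((sym2Equiv σ).symm z)

/-- `w^σ (σ̂ e) = w e`. [this work] -/
theorem relabelW_apply {n : ℕ} (σ : Equiv.Perm (Fin n)) (w : Sym2 (Fin n) → unitInterval) (z : Sym2 (Fin n)) :
    relabelW σ w (sym2Equiv σ z) = w z := by
  unfold relabelW
  rw [Equiv.symm_apply_apply]

/-- Probabilities transport: `P_w(σ̂⁻¹ S) = P_{w^σ}(S)`. [this work] -/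
theorem real_preimage_relabelW {n : ℕ} (σ : Equiv.Perm (Fin n)) (w : Sym2 (Fin n) → unitInterval)
    (S : Set (Set (Sym2 (Fin n)))) :
    (prodBernoulli w).real (BondConfig.relabel (sym2Equiv σ) ⁻¹' S) = (prodBernoulli (relabelW σ w)).real S :=
  prodBernoulli_real_preimage_relabel (sym2Equiv σ) w (relabelW σ w) (relabelW_apply σ w) S

/-- Two-point connections transport: `P_w(x ↔ y) = P_{w^σ}(σ x ↔ σ y)`. [this work] -/
theorem real_openConn_relabelW {n : ℕ} (σ : Equiv.Perm (Fin n)) (w : Sym2 (Fin n) → unitInterval) (x y : Fin n) :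
    (prodBernoulli w).real (openConn x y) = (prodBernoulli (relabelW σ w)).real (openConn (σ x) (σ y)) := by
  rw [← real_preimage_relabelW σ w, preimage_relabel_openConn]

/-- Two-point cuts transport. [this work] -/
theorem real_compl_openConn_relabelW {n : ℕ} (σ : Equiv.Perm (Fin n)) (w : Sym2 (Fin n) → unitInterval) (x y : Fin n) :
    (prodBernoulli w).real (openConn x y)ᶜ = (prodBernoulli (relabelW σ w)).real (openConn (σ x) (σ y))ᶜ := by
  rw [← real_preimage_relabelW σ w, Set.preimage_compl, preimage_relabel_openConn]

/-- The mean relay count transports: `Σ_{a ∈ σA} P_{w^σ}(σ o ↔ a) = Σ_{a ∈ A} P_w(o ↔ a)`. [this work] -/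
theorem sum_openConn_relabelW {n : ℕ} (σ : Equiv.Perm (Fin n)) (w : Sym2 (Fin n) → unitInterval)
    (A : Finset (Fin n)) (o : Fin n) :
    (∑ a ∈ A.map σ.toEmbedding, (prodBernoulli (relabelW σ w)).real (openConn (σ o) a)) =
      ∑ a ∈ A, (prodBernoulli w).real (openConn o a) := by
  rw [Finset.sum_map]
  exact Finset.sum_congr rfl fun a _ => (real_openConn_relabelW σ w o a).symm

/-- The relay-count filter transports along `σ`. [this work] -/
theorem card_filter_relabel {n : ℕ} (σ : Equiv.Perm (Fin n)) (A : Finset (Fin n)) (o : Fin n) (ω : BondConfig (Fin n)) :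
    ((A.map σ.toEmbedding).filter fun a => BondConfig.relabel (sym2Equiv σ) ω ∈ openConn (σ o) a).card =
      (A.filter fun a => ω ∈ openConn o a).card := by
  rw [Finset.filter_map, Finset.card_map]
  congr 1
  refine Finset.filter_congr fun a _ => ?_
  change BondConfig.relabel (sym2Equiv σ) ω ∈ openConn (σ o) (σ a) ↔ ω ∈ openConn o a
  rw [← Set.mem_preimage, preimage_relabel_openConn]

/-- **Relabelling invariance of the one-cut statement**: the one-cut bound for `(w, A, o, t)` follows from the one for
the relabelled data `(w^σ, σ A, σ o, t)`. [this work] -/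
theorem oneCut_of_relabel {n : ℕ} (σ : Equiv.Perm (Fin n)) (w : Sym2 (Fin n) → unitInterval)
    (A : Finset (Fin n)) (o : Fin n) (t : ℝ)
    (h : 0 ≤ t →
      (∀ a ∈ A.map σ.toEmbedding, ∀ a' ∈ A.map σ.toEmbedding, a ≠ a' →
        (prodBernoulli (relabelW σ w)).real (openConn a a')ᶜ ≤ t) →
      (prodBernoulli (relabelW σ w)).real {ω : BondConfig (Fin n) |
          1 ≤ ((A.map σ.toEmbedding).filter fun a => ω ∈ openConn (σ o) a).card ∧
          (((A.map σ.toEmbedding).filter fun a => ω ∈ openConn (σ o) a).card : ℝ) <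
            (∑ a ∈ A.map σ.toEmbedding, (prodBernoulli (relabelW σ w)).real (openConn (σ o) a)) / 2} ≤ t)
    (ht : 0 ≤ t) (hcut : ∀ a ∈ A, ∀ a' ∈ A, a ≠ a' → (prodBernoulli w).real (openConn a a')ᶜ ≤ t) :
    (prodBernoulli w).real {ω : BondConfig (Fin n) |
        1 ≤ (A.filter fun a => ω ∈ openConn o a).card ∧
        ((A.filter fun a => ω ∈ openConn o a).card : ℝ) <
          (∑ a ∈ A, (prodBernoulli w).real (openConn o a)) / 2} ≤ t := by
  -- hypotheses transported
  have hcut' : ∀ a ∈ A.map σ.toEmbedding, ∀ a' ∈ A.map σ.toEmbedding, a ≠ a' →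
      (prodBernoulli (relabelW σ w)).real (openConn a a')ᶜ ≤ t := by
    intro a ha a' ha' hne
    obtain ⟨x, hx, rfl⟩ := Finset.mem_map.1 ha
    obtain ⟨x', hx', rfl⟩ := Finset.mem_map.1 ha'
    have hxx : x ≠ x' := fun e => hne (by rw [e])
    rw [Equiv.toEmbedding_apply, Equiv.toEmbedding_apply, ← real_compl_openConn_relabelW σ w x x']
    exact hcut x hx x' hx' hxx
  have key := h ht hcut'
  -- the mean transports
  have hmean := sum_openConn_relabelW σ w A o
  rw [hmean] at key
  -- the event transports
  have hev : BondConfig.relabel (sym2Equiv σ) ⁻¹' {ω : BondConfig (Fin n) |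
        1 ≤ ((A.map σ.toEmbedding).filter fun a => ω ∈ openConn (σ o) a).card ∧
        (((A.map σ.toEmbedding).filter fun a => ω ∈ openConn (σ o) a).card : ℝ) <
          (∑ a ∈ A, (prodBernoulli w).real (openConn o a)) / 2} =
      {ω : BondConfig (Fin n) | 1 ≤ (A.filter fun a => ω ∈ openConn o a).card ∧
        ((A.filter fun a => ω ∈ openConn o a).card : ℝ) < (∑ a ∈ A, (prodBernoulli w).real (openConn o a)) / 2} := by
    ext ω
    simp only [Set.mem_preimage, Set.mem_setOf_eq, card_filter_relabel σ A o ω]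
  rw [← hev, real_preimage_relabelW]
  exact key

end Summit.CriticalPhenomena.PercolationContinuityZ3.Theorems.TwoCopy
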